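import Mathlib
import HarnessLib
import Summits.NavierStokesRegularity.NavierStokesRegularity.Theorems.TaylorModelRungThreeReadoutVTube
import Summits.NavierStokesRegularity.NavierStokesRegularity.Theorems.TaylorModelRungThreeReadoutFlowPackageVInStep
import Summits.NavierStokesRegularity.NavierStokesRegularity.Theorems.TaylorModelRungThreeReadoutG2Sigma
import Summits.NavierStokesRegularity.NavierStokesRegularity.Theorems.TaylorModelRungThreeReadoutJets

/-!
# Line `taylor-model` on crux K1b-DR (stmt-NavierStokesRegularity-23954) — G2-v: the CROSSING of the section in
# the last sub-step and K1b-DR's (E1) read-outs under the v3 certificate (`KBlockE1`)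

Setting as in `…ReadoutVTube`: `ChainVCore`, `IsFlowPackageV`, `ReadoutsV` and a polytope trajectory `φ j q`
with the G1-v node invariant (solves on `[0, Tn S]`, nodes in the level-1 hulls).  From the read-outs (R0) (`σf`
reads the window only; `Tn S ≤ τs`), (R4) (window M-bounds), (R5) (section before node `S−1` / after node `S`),
(R6) (in-step boxes `Y^l` over the last sub-step), (R7) (transversality on `Y¹`), (R8) (crossing read-outs), the
in-step transport (F8″) `inStep_meanValue_of_core` and the Taylor model (F5′) of the centre:

* `exists_inStepKer_diff` — (F8″) in KERNEL form: `φ(y)(u) − φ(x)(u) = kapp A (y − x)` on the window with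
  `InStepKer … u A`;
* `x_mem_hull`, `TP_eq_taylorSum` — the centre is in every hull; `TP` is the Taylor sum of the centre's jets;
* `stAt_mem_Y` — a trajectory started in the hull `H^l_{S−1}` stays in the in-step box `Y^l` during the last
  sub-step ((R6));
* `sigma_smoothV` — continuity AND derivative of `t ↦ σf (φ(q)(t))` (window-supported `σf`);
* `crossing_factsV` — the crossing time `tauSel cd φ j q`: `Tn (S−1) < τ ≤ Tn S`, `σf = lev` exactly there, `< lev`
  before on the last sub-step, `> lev` after, and the crossing state lies in `Y¹`;
* `kBlockE1_crossing_ofV` — `KBlockE1 cd φ (tauSel cd φ)` together with `0 ≤ τ ≤ Tn S` for every polytope point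
  (the G2-v interface `…ReadoutVTubeDeriv.kBlockTubeLip_ofV` consumes), given the G1-v node invariant.

MODEL-lattice rung TL-M3 only; nothing here is a statement about the Navier–Stokes equations.
-/

noncomputable section

-- the sub-problem namespace repeats the summit name by design (D-0017)
set_option linter.dupNamespace false

namespace Summit.NavierStokesRegularity.NavierStokesRegularity.Theorems.TaylorModelV

open Set Finset
open Literature.Analysis.FluidPDE.TaoCascade Literature.Analysis.FluidPDE.TaoCascade.TaylorChain
open Summit.NavierStokesRegularity.NavierStokesRegularity.Theorems.TaylorModelMajorant
open Summit.NavierStokesRegularity.NavierStokesRegularity.Theorems.TaylorModelVector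
open Summit.NavierStokesRegularity.NavierStokesRegularity.Theorems.TaylorModelReadout

variable {cd : CertData} {bx : StepBoxes} {rd : RadiiData} {ro : ReadoutData} {φ : Flow}

/-! ### (F8″) in kernel form; the centre; the in-step boxes -/

/-- **(F8″) in kernel form**: for two outer-hull starts `y, x` of sub-step `(j,s)` and `u ∈ [0,h]` there is a real
kernel `A` with `InStepKer cd bx j s u A` and `φ(y)(u) − φ(x)(u) = kapp A (y − x)` on the window. [folklore] -/
theorem exists_inStepKer_diff (hSN : cd.StageNumerics) (hC : ChainVCore cd bx) (hF : IsFlowPackageV cd bx φ)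
    {j : ℕ} (hj : j ≤ cd.N₀) {s : ℕ} (hs : s < cd.S j) {y x : Fin 4 → ℤ → ℝ}
    (hy : InBox cd (bx.hlo 2 j s) (bx.hhi 2 j s) y) (hx : InBox cd (bx.hlo 2 j s) (bx.hhi 2 j s) x)
    {u : ℝ} (hu : u ∈ Icc 0 (cd.h j s)) :
    ∃ A : Ker, InStepKer cd bx j s u A ∧
      ∀ i' k', -cd.Kb ≤ k' → k' ≤ cd.Ka → (stAt φ j y u - stAt φ j x u) i' k' = kapp cd A (y - x) i' k' := by
  obtain ⟨A, hA, hAeq⟩ := inStep_meanValue_of_core hSN hC hj hs hy hx hu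
  classical
  refine ⟨fun i' k' i k => if hk' : -cd.Kb ≤ k' ∧ k' ≤ cd.Ka then
      (if hk : -cd.Kb ≤ k ∧ k ≤ cd.Ka then A (eW cd (i', ⟨k', Finset.mem_Icc.2 hk'⟩)) (eW cd (i, ⟨k, Finset.mem_Icc.2 hk⟩))
        else 0) else 0, ?_, ?_⟩
  · intro i' k' hk1' hk2' i k hk1 hk2
    have hk' : -cd.Kb ≤ k' ∧ k' ≤ cd.Ka := ⟨hk1', hk2'⟩
    have hk : -cd.Kb ≤ k ∧ k ≤ cd.Ka := ⟨hk1, hk2⟩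
    simp only [dif_pos hk', dif_pos hk]
    set c : Fin (nW cd) := eW cd (i, ⟨k, Finset.mem_Icc.2 hk⟩) with hc
    set c' : Fin (nW cd) := eW cd (i', ⟨k', Finset.mem_Icc.2 hk'⟩) with hc'
    obtain ⟨-, ζ, hζ, hT⟩ := hA c c'
    refine ⟨ofVec cd ζ, ofVec_window_bounds (cd := cd) hζ, ?_⟩
    have e1 : ∀ n, varJet cd.Qb (ofVec cd ζ) (basisSt i k) n i' k' = varJet (Qw cd) ζ (Pi.single c 1) n c' := by
      intro n
      have h3 := congrFun (toVec_varJet (cd := cd) (ofVec cd ζ) (basisSt i k) n) c'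
      rw [toVec_ofVec, toVec_basisSt (cd := cd) i hk] at h3
      simp only [toVec, hc', modeOf, shellOf, Equiv.symm_apply_apply] at h3
      rw [← hc'] at h3
      simpa [hc] using h3
    have e3 : cd.ω j k = wW cd j c := by simp [wW, hc, shellOf]
    have e4 : bx.JU j s i' k' = toVec cd (bx.JU j s) c' := by simp [toVec, hc', modeOf, shellOf]
    rw [e3, e4]
    simp only [e1]
    exact hT
  · intro i' k' hk1' hk2'
    have hk' : -cd.Kb ≤ k' ∧ k' ≤ cd.Ka := ⟨hk1', hk2'⟩
    have e : ∀ z, stAt φ j z u = stAt (fun _ => liftFlow cd (fun x s => flowSel (Qw cd) x s)) j z u := by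
      intro z; funext i k; exact hF.1 j z i k u
    rw [e, e, hAeq i' k' hk1' hk2', kapp, if_pos hk']
    refine Finset.sum_congr rfl fun c _ => ?_
    simp only [dif_pos hk', dif_pos (shellOf_mem cd c), eW_modeOf_shellOf, toVec_sub, Pi.sub_apply]

section Stage


/-- The centre `x j s` lies in every hull `H^l_s` (`NodeStart l (x j s)` with `ξ = 0`). [folklore] -/
theorem x_mem_hull (hC : ChainVCore cd bx) {j : ℕ} (hj : j ≤ cd.N₀) {s : ℕ} (hs : s ≤ cd.S j) (l : Fin 3) :
    InBox cd (bx.hlo l j s) (bx.hhi l j s) (cd.x j s) := by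
  obtain ⟨-, -, hCm, -, -, -, -, -, -, -, hr0, -, hNS, -⟩ := (hC j hj).2.2.1 s hs
  refine hNS l _ ⟨0, fun i k _ _ => by simpa using hr0 l i k, ?_⟩
  rw [hCm.map_zero, add_zero]

/-- `TP j s u` is the Taylor sum of the centre's jets: `Σ_{n≤pdeg} taylorJet cd.Qb (x j s) n · u^n` (the a-block
recursion + uniqueness of the truncated recursion). [folklore] -/
theorem TP_eq_taylorSum (hC : ChainVCore cd bx) {j : ℕ} (hj : j ≤ cd.N₀) {s : ℕ} (hs : s ≤ cd.S j) (u : ℝ) :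
    cd.TP j s u = fun i k => ∑ n ∈ Finset.range (cd.pdeg + 1), taylorJet cd.Qb (cd.x j s) n i k * u ^ n := by
  obtain ⟨-, -, -, -, -, hP0, hPrec, -⟩ := (hC j hj).2.2.1 s hs
  have hrec : ∀ n, n < cd.pdeg → ((n : ℝ) + 1) • cd.P j s (n + 1) =
      ∑ m ∈ Finset.range (n + 1), cd.Qb (cd.P j s m) (cd.P j s (n - m)) := by
    intro n hn
    funext i k
    rw [Pi.smul_apply, Pi.smul_apply, smul_eq_mul, hPrec n hn i k, Finset.sum_apply, Finset.sum_apply]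
  have hP := eq_taylorJet_of_rec (Q := cd.Qb) (x := cd.x j s) hP0 hrec
  funext i k
  simp only [CertData.TP]
  refine Finset.sum_congr rfl fun n hn => ?_
  rw [hP n (Nat.lt_succ_iff.1 (Finset.mem_range.1 hn))]

end Stage

section Last


/-- **In-step boxes of the last sub-step ((R6) + (F8″) + (F5′)).** A trajectory started in the hull `H^l_{S−1}`
(`l = 0`: centre set, `l = 1`: polytope set) stays in `Y^l = [ylo l, yhi l]` during the last sub-step. [folklore] -/
theorem stAt_mem_Y (hSN : cd.StageNumerics) (hC : ChainVCore cd bx) (hF : IsFlowPackageV cd bx φ) (hRO : ReadoutsV cd bx rd ro) {j : ℕ} (hj : j ≤ cd.N₀) (l : Fin 2) {y : Fin 4 → ℤ → ℝ}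
    (hy : InBox cd (bx.hlo (hullLevel l) j (cd.S j - 1)) (bx.hhi (hullLevel l) j (cd.S j - 1)) y)
    {u : ℝ} (hu : u ∈ Icc 0 (cd.h j (cd.S j - 1))) :
    InBox cd (ro.ylo l j) (ro.yhi l j) (stAt φ j y u) := by
  have hS : 1 ≤ cd.S j := (hC j hj).1
  have hs : cd.S j - 1 < cd.S j := Nat.sub_lt hS Nat.one_pos
  obtain ⟨-, -, -, -, -, -, -, -, -, -, -, -, hR6, -⟩ := hRO j hj
  -- the start and the centre are outer-hull starts
  have hy2 : InBox cd (bx.hlo 2 j (cd.S j - 1)) (bx.hhi 2 j (cd.S j - 1)) y := by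
    obtain ⟨-, -, -, -, -, -, -, -, -, -, -, -, -, hnest⟩ := (hC j hj).2.2.1 _ hs.le
    intro i k hk1 hk2
    exact ⟨(hnest _ i k).1.trans (hy i k hk1 hk2).1, (hy i k hk1 hk2).2.trans (hnest _ i k).2⟩
  have hx2 := x_mem_hull hC hj hs.le (2 : Fin 3)
  obtain ⟨A, hA, hAeq⟩ := exists_inStepKer_diff hSN hC hF hj hs hy2 hx2 hu
  -- the centre's Taylor model (F5′) against `TP`
  obtain ⟨-, -, -, hF5, -⟩ := ((hF.2 j hj).2.2 _ hs)
  have hrem : AbsLeW cd (stAt φ j (cd.x j (cd.S j - 1)) u - cd.TP j (cd.S j - 1) u)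
      (fun i k => bx.J j (cd.S j - 1) i k * u ^ (cd.pdeg + 1)) := by
    intro i k hk1 hk2
    have h1 := hF5 _ hx2 u hu i k hk1 hk2
    rw [TP_eq_taylorSum hC hj hs.le]
    exact h1
  have h := hR6 l u hu A hA y hy _ hrem
  -- `stAt y u = TP u + (stAt x u − TP u) + kapp A (y − x)` on the window
  intro i k hk1 hk2
  have h1 := h i k hk1 hk2
  have h2 := hAeq i k hk1 hk2
  simp only [Pi.add_apply, Pi.sub_apply] at h1 h2 ⊢
  constructor <;> linarith [h1.1, h1.2, h2]


/-- **The section value along a polytope trajectory is C¹** (window-supported `σf`, (R0)): continuous on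
`[0, Tn S]` with derivative `σf (Qb (φ(q)(t), φ(q)(t)))` within `[0, Tn S]`. [folklore] -/
theorem sigma_smoothV (hRO : ReadoutsV cd bx rd ro) {j : ℕ} (hj : j ≤ cd.N₀) {q : Fin 4 → ℤ → ℝ} (hq : SolvesOn cd φ j q (cd.Tn j (cd.S j))) :
    ContinuousOn (fun s => cd.σf j (stAt φ j q s)) (Icc 0 (cd.Tn j (cd.S j))) ∧
      ∀ t ∈ Icc 0 (cd.Tn j (cd.S j)), HasDerivWithinAt (fun s => cd.σf j (stAt φ j q s))
        (cd.σf j (cd.Qb (stAt φ j q t) (stAt φ j q t))) (Icc 0 (cd.Tn j (cd.S j))) t := by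
  obtain ⟨-, -, -, -, hσw, -⟩ := hRO j hj
  let L : (Fin (nW cd) → ℝ) →L[ℝ] ℝ :=
    LinearMap.toContinuousLinearMap ((cd.σf j).comp (IsLinearMap.mk' (ofVec cd) ⟨ofVec_add cd, ofVec_smul cd⟩))
  have hL : ∀ y : Fin 4 → ℤ → ℝ, cd.σf j y = L (toVec cd y) := by
    intro y
    show cd.σf j y = cd.σf j (ofVec cd (toVec cd y))
    rw [ofVec_toVec]
    exact hσw y
  have hder : ∀ t ∈ Icc 0 (cd.Tn j (cd.S j)), HasDerivWithinAt (fun s => cd.σf j (stAt φ j q s))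
      (cd.σf j (cd.Qb (stAt φ j q t) (stAt φ j q t))) (Icc 0 (cd.Tn j (cd.S j))) t := by
    intro t ht
    have hX : HasDerivWithinAt (fun s => toVec cd (stAt φ j q s)) (toVec cd (cd.qT (stAt φ j q t)))
        (Icc 0 (cd.Tn j (cd.S j))) t := by
      refine hasDerivWithinAt_pi.2 fun c => ?_
      have hk := shellOf_mem cd c
      have h1 := (hq (modeOf cd c) (shellOf cd c) hk.1 hk.2).2 t ht
      rw [quadTerm_trunc_eq_qT (cd := cd) _ _ hk] at h1
      exact h1
    have h2 := L.hasFDerivAt.comp_hasDerivWithinAt t hX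
    have hfun : (fun s => cd.σf j (stAt φ j q s)) = ⇑L ∘ fun s => toVec cd (stAt φ j q s) := by
      funext s; exact hL _
    have hval : L (toVec cd (cd.qT (stAt φ j q t))) = cd.σf j (cd.Qb (stAt φ j q t) (stAt φ j q t)) := by
      rw [Qb_self, ← hL]
    rw [hfun, ← hval]
    exact h2
  exact ⟨fun t ht => (hder t ht).continuousWithinAt, hder⟩

/-- **The crossing in the last sub-step.** With `τ := tauSel cd φ j q`: `Tn (S−1) < τ ≤ Tn S`, `σf (φ(q)(τ)) = lev`,
`σf < lev` on `[Tn (S−1), τ)`, `lev < σf` on `(τ, Tn S]`, and the crossing state lies in the in-step box `Y¹`.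
[folklore] -/
theorem crossing_factsV (hSN : cd.StageNumerics) (hC : ChainVCore cd bx) (hF : IsFlowPackageV cd bx φ) (hRO : ReadoutsV cd bx rd ro) {j : ℕ} (hj : j ≤ cd.N₀) {q : Fin 4 → ℤ → ℝ} (hq : SolvesOn cd φ j q (cd.Tn j (cd.S j))) (hqN : ∀ s, s ≤ cd.S j → InBox cd (bx.hlo 1 j s) (bx.hhi 1 j s) (stAt φ j q (cd.Tn j s))) :
    cd.Tn j (cd.S j - 1) < tauSel cd φ j q ∧ tauSel cd φ j q ≤ cd.Tn j (cd.S j) ∧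
      cd.σf j (stAt φ j q (tauSel cd φ j q)) = cd.lev j ∧
      (∀ t, cd.Tn j (cd.S j - 1) ≤ t → t < tauSel cd φ j q → cd.σf j (stAt φ j q t) < cd.lev j) ∧
      (∀ t, tauSel cd φ j q < t → t ≤ cd.Tn j (cd.S j) → cd.lev j < cd.σf j (stAt φ j q t)) ∧
      InBox cd (ro.ylo 1 j) (ro.yhi 1 j) (stAt φ j q (tauSel cd φ j q)) := by
  have hS : 1 ≤ cd.S j := (hC j hj).1
  have hs : cd.S j - 1 < cd.S j := Nat.sub_lt hS Nat.one_pos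
  have hU := isUniqueFlow_of_packageV hF
  obtain ⟨-, -, hγ, -, -, -, -, -, -, -, hR5a, hR5b, -, hR7, -⟩ := hRO j hj
  have hTs := ((gridV hC hj).2.1 _ hs).2
  rw [Nat.sub_add_cancel hS] at hTs
  have h0 : 0 ≤ cd.Tn j (cd.S j - 1) := (gridV hC hj).2.2.2 _ hs.le
  have hab : cd.Tn j (cd.S j - 1) ≤ cd.Tn j (cd.S j) := by rw [hTs]; linarith [((gridV hC hj).2.1 _ hs).1]
  -- the trajectory during the last sub-step lies in `Y¹`
  have hshift := (polyNode_shift hC hF hj hq hs.le).2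
  have hY : ∀ t, cd.Tn j (cd.S j - 1) ≤ t → t ≤ cd.Tn j (cd.S j) →
      InBox cd (ro.ylo 1 j) (ro.yhi 1 j) (stAt φ j q t) := by
    intro t h1 h2
    rw [hshift t ⟨h1, h2⟩]
    exact stAt_mem_Y hSN hC hF hRO hj 1 (hqN _ hs.le) ⟨by linarith, by rw [hTs] at h2; linarith⟩
  -- strict monotonicity of the section value on the last sub-step
  obtain ⟨hcont, hder⟩ := sigma_smoothV hRO hj hq
  have hmono : StrictMonoOn (fun s => cd.σf j (stAt φ j q s)) (Icc (cd.Tn j (cd.S j - 1)) (cd.Tn j (cd.S j))) := by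
    refine strictMonoOn_of_deriv_pos (convex_Icc _ _) (hcont.mono (Icc_subset_Icc_left h0)) ?_
    intro x hx
    rw [interior_Icc] at hx
    have hd := hder x ⟨h0.trans hx.1.le, hx.2.le⟩
    rw [(hd.hasDerivAt (Icc_mem_nhds (h0.trans_lt hx.1) hx.2)).deriv]
    exact hγ.trans_le (hR7 _ (hY x hx.1.le hx.2.le))
  -- signs at the two nodes
  have hlt : cd.σf j (stAt φ j q (cd.Tn j (cd.S j - 1))) < cd.lev j := hR5a _ (hqN _ hs.le)
  have hgt : cd.lev j < cd.σf j (stAt φ j q (cd.Tn j (cd.S j))) := hR5b _ (hqN _ le_rfl)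
  obtain ⟨τ, hL, h1, h2, h3, h4, h5⟩ :=
    G2.exists_isLeast_crossing hab (hcont.mono (Icc_subset_Icc_left h0)) hmono hlt hgt
  have hτ : tauSel cd φ j q = τ := hL.csInf_eq.symm ▸ rfl
  · rw [hτ]
    exact ⟨h1, h2, h3, h4, h5, hY τ h1.le h2⟩

/-- **K1b-DR's (E1) block at stage `j` for the polytope point `q`**, with the crossing-time bounds
`0 ≤ τ ≤ Tn S` (τ := `tauSel`): `0 < τ ≤ τs`, `as ≤ |φ(q)(τ)_{i₀,1}|`, `φ(q)(0) = q`, the window bounds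
`|φ(q)(t)| ≤ M − Λδτs·ω − mm` on `[0, τ]`, and the behind-shell bound at `τ`. [folklore] -/
theorem readE1_ofV (hSN : cd.StageNumerics) (hC : ChainVCore cd bx) (hF : IsFlowPackageV cd bx φ) (hRO : ReadoutsV cd bx rd ro) {j : ℕ} (hj : j ≤ cd.N₀) {q : Fin 4 → ℤ → ℝ} (hq : SolvesOn cd φ j q (cd.Tn j (cd.S j))) (hqN : ∀ s, s ≤ cd.S j → InBox cd (bx.hlo 1 j s) (bx.hhi 1 j s) (stAt φ j q (cd.Tn j s))) :
    (0 ≤ tauSel cd φ j q ∧ tauSel cd φ j q ≤ cd.Tn j (cd.S j)) ∧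
    0 < tauSel cd φ j q ∧ tauSel cd φ j q ≤ cd.τs ∧ cd.as j ≤ |φ j q cd.i₀ 1 (tauSel cd φ j q)| ∧
      (∀ i k, -cd.Kb ≤ k → k ≤ cd.Ka → φ j q i k 0 = q i k ∧ ∀ t ∈ Icc 0 (tauSel cd φ j q),
        |φ j q i k t| ≤ cd.M k - cd.Λ j * cd.δ j * cd.τs * cd.ω j k - cd.mm) ∧
      (∀ i, |φ j q i (-cd.Kb) (tauSel cd φ j q)| + cd.Λ j * cd.δ j * cd.τs * cd.ω j (-cd.Kb) ≤
        (2:ℝ) ^ (-cd.θ) * (cd.Cb * (2:ℝ) ^ ((3:ℝ) / 4 * ((cd.Kb:ℝ) + 1)))) := by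
  have hS : 1 ≤ cd.S j := (hC j hj).1
  obtain ⟨hτs, -, -, -, -, -, -, -, -, hR4, -, -, -, -, hR8, -⟩ := hRO j hj
  obtain ⟨h1, h2, h3, -, -, hY⟩ := crossing_factsV hSN hC hF hRO hj hq hqN
  have h0 : 0 ≤ cd.Tn j (cd.S j - 1) := (gridV hC hj).2.2.2 _ (Nat.sub_le _ _)
  have hpos : 0 < tauSel cd φ j q := h0.trans_lt h1
  obtain ⟨has, hbs⟩ := hR8 _ hY h3
  refine ⟨⟨hpos.le, h2⟩, hpos, h2.trans hτs, has, fun i k hk1 hk2 => ⟨(hq i k hk1 hk2).1, fun t ht => ?_⟩,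
    fun i => hbs i⟩
  -- window bounds along `[0, τ] ⊆ [0, Tn S]`: locate the sub-step of `t` and use (F1′) + (R4)
  have hS0 : 0 < cd.S j := hS
  have hT0 : cd.Tn j 0 ≤ t := by rw [(gridV hC hj).1]; exact ht.1
  obtain ⟨s, -, hs, hts, hts1⟩ := G3.exists_substep (cd := cd) (j := j) hS0 hT0 (ht.2.trans h2)
  obtain ⟨-, hB⟩ := polyNode_solves_inBox hC hF hj hq hs (hqN s hs.le)
  have hTs := ((gridV hC hj).2.1 _ hs).2
  have hu : t - cd.Tn j s ∈ Icc 0 (cd.h j s) := ⟨by linarith, by rw [hTs] at hts1; linarith⟩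
  have hst : stAt φ j q t = stAt φ j (stAt φ j q (cd.Tn j s)) (t - cd.Tn j s) :=
    (polyNode_shift hC hF hj hq hs.le).2 t ⟨hts, ht.2.trans h2⟩
  have hb := hB _ hu i k hk1 hk2
  rw [← hst] at hb
  have h4 := hR4 s hs i k hk1 hk2
  have e : φ j q i k t = stAt φ j q t i k := rfl
  rw [e, abs_le]
  constructor <;> linarith [hb.1, hb.2, h4.2.2.1, h4.2.2.2]

end Last

/-! ### The (E1) block for all stages -/

/-- **`KBlockE1 cd φ (tauSel cd φ)` and `0 ≤ τ ≤ Tn S` from the v3 certificate**, given the G1-v node invariant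
of every polytope trajectory. [folklore] -/
theorem kBlockE1_crossing_ofV (hSN : cd.StageNumerics) (hC : ChainVCore cd bx) (hF : IsFlowPackageV cd bx φ)
    (hRO : ReadoutsV cd bx rd ro)
    (hPN : ∀ j, j ≤ cd.N₀ → ∀ q, InPoly cd j q →
      SolvesOn cd φ j q (cd.Tn j (cd.S j)) ∧
        ∀ s, s ≤ cd.S j → InBox cd (bx.hlo 1 j s) (bx.hhi 1 j s) (stAt φ j q (cd.Tn j s))) :
    KBlockE1 cd φ (tauSel cd φ) ∧
      ∀ j, j ≤ cd.N₀ → ∀ q, InPoly cd j q → 0 ≤ tauSel cd φ j q ∧ tauSel cd φ j q ≤ cd.Tn j (cd.S j) := by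
  constructor
  · intro j hj q hq
    obtain ⟨hqS, hqN⟩ := hPN j hj q hq
    exact (readE1_ofV hSN hC hF hRO hj hqS hqN).2
  · intro j hj q hq
    obtain ⟨hqS, hqN⟩ := hPN j hj q hq
    exact (readE1_ofV hSN hC hF hRO hj hqS hqN).1

end Summit.NavierStokesRegularity.NavierStokesRegularity.Theorems.TaylorModelV

end
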